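import Summits.HodgeConjecture.HodgeConjecture.Theorems.NikulinTwinTransportTwinSimilitudeAlgebraicStubCMCayleyDecomposition
import Summits.HodgeConjecture.HodgeConjecture.Theorems.NikulinTwinTransportTwinSimilitudeAlgebraicStubCMPolyComplexify
import Summits.HodgeConjecture.HodgeConjecture.Theorems.NikulinTwinTransportTwinSimilitudeAlgebraicStubCMRationalForm
import Summits.HodgeConjecture.HodgeConjecture.Theorems.NikulinTwinTransportTwinSimilitudeAlgebraicStubCMSelfSimilitudeFromIsometries
import Summits.HodgeConjecture.HodgeConjecture.Theorems.NikulinTwinTransportTwinSimilitudeAlgebraicCMNormTwins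
import Summits.HodgeConjecture.HodgeConjecture.Theorems.NikulinTwinTransportTwinSimilitudeAlgebraicStubHodgeK3FactsAux
import Summits.HodgeConjecture.HodgeConjecture.Theorems.NikulinTwinTransportTwinSimilitudeAlgebraicStubDivisorCorrections
import Summits.HodgeConjecture.HodgeConjecture.Theorems.NikulinTwinTransportLefschetzOneOneK3Closing
import HarnessLib

/-!
# Route NikulinTwinTransport · crux X = `TwinSimilitudeAlgebraic` (stmt-HodgeConjecture-13674) —
# THE CM-NORM-2 LOCUS FROM BUSKIN'S THEOREM ALONE (line `hyperkaehler-nikulin-anchors`, reshape r11, lead c6)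

Lead c5 proved X at every twin pair with a CM-norm-2 twin (`…CMNormTwins`), and the transport crux
`TwinTwistorTransport` (14393) at every CM-norm-2 K3 surface, GRANTED Buskin's CM COROLLARY — the named fact
`Buskin2019_hodgeConjectureFor_square_of_CM` (HC for `S × S` of a CM K3 surface), consumed at ONE place: the
algebraicity of the CM-norm-2 self-similitude `e` (`outAnchor_self_of_cmNorm`).  This file removes that named
fact from the cone of X.  The algebraicity of `e` follows from Buskin's THEOREM (route item 13675,
`HodgeIsometryAlgebraic`: rational Hodge ISOMETRIES are algebraic) by the Cayley-transform decomposition of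
reshape r11, whose four registered stubs are LANDED (wave 1 of lead c6): `stub_cmCayleyDecomposition`
(p126263: over `ℚ`, `J = Σᵢ cᵢ qᵢ(J) + Σₗ B(·, aₗ) bₗ` with every `qᵢ(J)` an isometry — `u₀ = ½J²`,
`u_a = (J + a)(2J⁻¹ + a)⁻¹`, `a·J·(u_a − 1) = 2(u₀ − u_a)`, minimal polynomial of `u_a − 1`),
`stub_cmPolyComplexify` (p126334), `stub_cmRationalForm` (p126486: the `ℚ`-form of a CM-norm-2 structure; the
geometric input "`J² − 2` injective on `NS_ℚ^⊥`" from `t² ≠ 2` + Lefschetz `(1,1)` + Hodge index) and the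
assembly `stub_cmSelfSimilitudeFromIsometries` (p126672: each `η⁻¹qᵢ(J)η` is a rational Hodge isometry of
`H²(S)`, algebraic by 13675; each `x ↦ (x.aₗ) bₗ` is a divisor correspondence, algebraic by
`stub_divisorCorrections`; sum up).  Lefschetz `(1,1)` (13678, `lefschetzOneOneK3_proof`),
`AlgebraicClassesOneOneK3` (15041) and the Hodge index theorem for K3 surfaces (`hodgeIndex_K3_of_marking`) are
THEOREMS of the tree and enter by their proofs.

* `cmNorm_selfSimilitude_algebraic` — **a rational `2`-self-similitude of `H²(S)` with a non-real eigenvalue on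
  `H^{2,0}` is algebraic**, granted ONLY K3 markings and `HodgeIsometryAlgebraic`.
* `outAnchor_self_of_cmNorm_of_isometries` — a CM-norm-2 projective K3 surface is its own algebraic `2`-anchor
  (verbatim `outAnchor_self_of_cmNorm` with the corollary replaced by the theorem above).
* `twinSimilitudeAlgebraic_at_of_cmNorm_either_of_isometries` — **X at every pair with a CM-norm-2 source or
  target**, granted markings, 13675 and `CupProductAlgebraic` (14350) only; no sector hypothesis, any rank of `T`.
* `twinTwistorTransport_at_of_cmNorm_of_isometries` — 14393 at every CM-norm-2 K3 surface, from markings + 13675.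
* `twinSimilitudeAlgebraic_of_offSectorNonCMPairs_of_isometries` — **X from the named facts of the line (markings,
  F1–F4, Voisin I 11.32 ⊗ ℂ), Buskin's theorem 13675 and the r9 residual `OffSectorNonCMPairs` ALONE** (no CM
  corollary, no Lefschetz hypothesis).
* `cmNormFromIsometries_anchor` — registered anchor of this file on the crux item.

No definitions, no new named facts, no `sorry`.

## References

* [Buskin2019] N. Buskin, J. reine angew. Math. 755 (2019), Thm. 1.1 and Corollary (Introduction), §6.2.
* [Huybrechts2019] D. Huybrechts, Comment. Math. Helv. 94 (2019), Cor. 0.4 (ii) and Rem. 3.3 (a CM endomorphism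
  field is spanned by Hodge isometries).
* [Huybrechts2016K3] D. Huybrechts, Lectures on K3 Surfaces, CUP 2016, Ch. 3 §3 (Cor. 3.6, Thm. 3.7).
* [Varesco2023] M. Varesco, Math. Z. 305 (2023), §0.1.
-/

noncomputable section

set_option linter.dupNamespace false

open CategoryTheory MonoidalCategory
open scoped Manifold Matrix
open Literature.AlgebraicGeometry.Motives Literature.AlgebraicGeometry.HodgeTheory
open Literature.AlgebraicGeometry.Surfaces Literature.AlgebraicGeometry.Hyperkaehler Literature.Geometry.Kaehler
open Literature.AlgebraicTopology.SingularHomology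
open Summit.HodgeConjecture.HodgeConjecture.Theses.NikulinTwinTransport

namespace Summit.HodgeConjecture.HodgeConjecture.Theorems.NikulinTwinTransport

/-! ## Local notations (verbatim those of the route's Theorems files) -/

/-- `Gen[S, p]`: `p` is an integral generator of `H⁴(S(ℂ); ℂ)` (the generator clause of X). Local notation
only. -/
local notation3 (prettyPrint := false) "Gen[" S ", " p "]" =>
  (IsIntegralClass p ∧ ∀ q : complexBetti S (2 * 2), IsIntegralClass q → ∃ n : ℤ, q = n • p)

/-- `Corr[μ, S, S', hS, hS' ; γ, y] = [γ]_* y = fst_*(snd^* y ∪ γ)`, the action of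
`γ ∈ H⁴((S ⊗ S′)(ℂ); ℂ)` as a correspondence `H²(S′) → H²(S)` (the FIRST factor receives). Local notation
only, verbatim from the route's Theorems files. -/
local notation3 (prettyPrint := false) "Corr[" μ ", " S ", " S' ", " hS ", " hS' " ; " γ ", " y "]" =>
  complexGysin μ
    (IsSmoothProjective.tensor_holds (IsK3Surface.isSmoothProjective hS)
      (IsK3Surface.isSmoothProjective hS'))
    (IsK3Surface.isSmoothProjective hS) (SemiCartesianMonoidalCategory.fst S S')
    (rfl : 2 * 1 + 2 * 2 + 2 * 2 = 2 * 1 + 2 * (2 + 2))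
    (cupProduct (rfl : 2 * 1 + 2 * 2 = 2 * 1 + 2 * 2)
      (complexBetti.map (SemiCartesianMonoidalCategory.snd S S') (2 * 1) y) γ)

/-- `XBody[μ, S, S', hS, hS', p, p']`: the body of X at one pair after the generator prefix. Local notation
only (verbatim the corresponding segment of the route decl). -/
local notation3 (prettyPrint := false) "XBody[" μ ", " S ", " S' ", " hS ", " hS' ", " p ", " p' "]" =>
  ∀ (ψ : complexBetti S' (2 * 1) →ₗ[ℂ] complexBetti S (2 * 1)),
    (∀ x, IsRationalClass x → IsRationalClass (ψ x)) →
    (∀ (i j : ℕ) x, IsOfHodgeType 2 S' (2 * 1) i j x → IsOfHodgeType 2 S (2 * 1) i j (ψ x)) →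
    (∀ (x y : complexBetti S' (2 * 1)) (a : ℂ),
      cupProduct (rfl : 2 * 1 + 2 * 1 = 2 * 2) x y = a • p' →
        cupProduct (rfl : 2 * 1 + 2 * 1 = 2 * 2) (ψ x) (ψ y) = ((2 : ℂ) * a) • p) →
    ∃ γ ∈ algebraicClasses (MonoidalCategoryStruct.tensorObj S S') 2,
      ∀ x : complexBetti S' (2 * 1), ψ x = Corr[μ, S, S', hS, hS' ; γ, x]

/-- `CMNorm2[S, p]`: **`S` is CM-norm-2** — `H²(S(ℂ); ℂ)` carries a rational `2`-self-similitude `e` acting on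
a non-zero `(2,0)`-class by a non-real scalar. Local notation only, verbatim that of `…CMNormSelfAnchor`.
[cite: Huybrechts2016K3, Ch. 3 Thm. 3.7 and Rem. 3.10] [cite: Zarhin1983HodgeGroupsK3, Thm. 1.5.1] -/
local notation3 (prettyPrint := false) "CMNorm2[" S ", " p "]" =>
  ∃ e : complexBetti S (2 * 1) →ₗ[ℂ] complexBetti S (2 * 1),
    (∀ x, IsRationalClass x → IsRationalClass (e x)) ∧
    (∀ (x y : complexBetti S (2 * 1)) (a : ℂ),
      cupProduct (rfl : 2 * 1 + 2 * 1 = 2 * 2) x y = a • p →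
        cupProduct (rfl : 2 * 1 + 2 * 1 = 2 * 2) (e x) (e y) = ((2 : ℂ) * a) • p) ∧
    ∃ (σ : complexBetti S (2 * 1)) (t : ℂ), IsOfHodgeType 2 S (2 * 1) 2 0 σ ∧ σ ≠ 0 ∧ t.im ≠ 0 ∧ e σ = t • σ

/-- `OutAnchor[μ, S, Sg, hS, hSg, p, pg]`: an algebraic OUT-anchor `2`-similitude at `S` with partner `Sg`
(verbatim the notation of `…CMNormSelfAnchor` / `…HKSectorTheorem`). Local notation only. -/
local notation3 (prettyPrint := false)
    "OutAnchor[" μ ", " S ", " Sg ", " hS ", " hSg ", " p ", " pg "]" =>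
  ∃ Ψ : complexBetti S (2 * 1) ≃ₗ[ℂ] complexBetti Sg (2 * 1),
    (∀ y, IsRationalClass y → IsRationalClass (Ψ.symm y)) ∧
    (∀ (i j : ℕ) y, IsOfHodgeType 2 Sg (2 * 1) i j y →
      IsOfHodgeType 2 S (2 * 1) i j (Ψ.symm y)) ∧
    (∀ (u v : complexBetti Sg (2 * 1)) (b : ℂ),
      cupProduct (rfl : 2 * 1 + 2 * 1 = 2 * 2) u v = ((2 : ℂ) * b) • pg →
        cupProduct (rfl : 2 * 1 + 2 * 1 = 2 * 2) (Ψ.symm u) (Ψ.symm v) = b • p) ∧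
    ∃ γ ∈ algebraicClasses (MonoidalCategoryStruct.tensorObj Sg S) 2,
      ∀ x : complexBetti S (2 * 1), Ψ x = Corr[μ, Sg, S, hSg, hS ; γ, x]

/-- `AnchorData[μ, S, hS, p]`: the body of the transport crux `TwinTwistorTransport` (stmt-HodgeConjecture-14393) at `S`
after its `∀ μ, PD → ∀ S hS p, Gen →` prefix (verbatim the notation of `…CMNormTwins`). Local notation only. -/
local notation3 (prettyPrint := false) "AnchorData[" μ ", " S ", " hS ", " p "]" =>
  ∃ (S'' : SchemeOver ℂ) (hS'' : IsK3Surface S'') (p'' : complexBetti S'' (2 * 2)),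
    Gen[S'', p''] ∧
    ∃ Ψ : complexBetti S'' (2 * 1) ≃ₗ[ℂ] complexBetti S (2 * 1),
      (∀ y, IsRationalClass y → IsRationalClass (Ψ.symm y)) ∧
      (∀ (i j : ℕ) y, IsOfHodgeType 2 S (2 * 1) i j y →
        IsOfHodgeType 2 S'' (2 * 1) i j (Ψ.symm y)) ∧
      (∀ (u v : complexBetti S (2 * 1)) (b : ℂ),
        cupProduct (rfl : 2 * 1 + 2 * 1 = 2 * 2) u v = ((2 : ℂ) * b) • p →
          cupProduct (rfl : 2 * 1 + 2 * 1 = 2 * 2) (Ψ.symm u) (Ψ.symm v) = b • p'') ∧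
      ∃ γ ∈ algebraicClasses (MonoidalCategoryStruct.tensorObj S S'') 2,
        ∀ x : complexBetti S'' (2 * 1), Ψ x = Corr[μ, S, S'', hS, hS'' ; γ, x]

/-- `OffSectorNonCMPairs`: the r9 residual of line `hyperkaehler-nikulin-anchors` — X verbatim for pairs with BOTH
twins off the HK-Nikulin sector AND NEITHER twin CM-norm-2 (verbatim the notation of `…CMNormTwins` = the
skeleton's `def`). Local notation only. [cite: Varesco2023, §0.1, Thm. 2.1 and Prop. 2.5] -/
local notation3 (prettyPrint := false) "OffSectorNonCMPairs" =>
  ∀ (μ : OrientationFamily), μ.HasPoincareDuality →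
    ∀ (S S' : SchemeOver ℂ) (hS : IsK3Surface S) (hS' : IsK3Surface S')
      (p : complexBetti S (2 * 2)) (p' : complexBetti S' (2 * 2)), Gen[S, p] → Gen[S', p'] →
      ∀ (ψ : complexBetti S' (2 * 1) →ₗ[ℂ] complexBetti S (2 * 1)),
        (∀ x, IsRationalClass x → IsRationalClass (ψ x)) →
        (∀ (i j : ℕ) x, IsOfHodgeType 2 S' (2 * 1) i j x → IsOfHodgeType 2 S (2 * 1) i j (ψ x)) →
        (∀ (x y : complexBetti S' (2 * 1)) (a : ℂ),
          cupProduct (rfl : 2 * 1 + 2 * 1 = 2 * 2) x y = a • p' →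
            cupProduct (rfl : 2 * 1 + 2 * 1 = 2 * 2) (ψ x) (ψ y) = ((2 : ℂ) * a) • p) →
        ¬ InHKNikulinSector S' → ¬ InHKNikulinSector S → ¬ CMNorm2[S', p'] → ¬ CMNorm2[S, p] →
        ∃ γ ∈ algebraicClasses (MonoidalCategoryStruct.tensorObj S S') 2,
          ∀ x : complexBetti S' (2 * 1), ψ x = Corr[μ, S, S', hS, hS' ; γ, x]

/-! ## A CM-norm-2 self-similitude is algebraic — from Buskin's theorem -/

/-- **A rational `2`-self-similitude of `H²(S)` with a non-real eigenvalue on a non-zero `(2,0)`-class is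
ALGEBRAIC** (`e = [γ]_*`, `γ ∈ N²H⁴(S × S)`), for every projective K3 surface `S` and generator `p` of `H⁴`,
granted ONLY the existence of K3 markings and Buskin's theorem `HodgeIsometryAlgebraic` (route item 13675).  This
is the landed assembly `stub_cmSelfSimilitudeFromIsometries` fed with the three landed worker stubs of reshape r11
and with the tree's theorems Lefschetz `(1,1)` (`lefschetzOneOneK3_proof`), `AlgebraicClassesOneOneK3`
(`algebraicClassesOneOneK3_proof`), Hodge index for K3 surfaces (`hodgeIndex_K3_of_marking`) and
`stub_divisorCorrections`.  Printed source of the argument: a CM endomorphism field of `T(S)_ℚ` is spanned by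
Hodge isometries (Huybrechts 2019, Rem. 3.3), made explicit and irreducibility-free by the Cayley transform
`u_a = (e + a)(ē + a)⁻¹`. [cite: Buskin2019, Thm. 1.1 and Corollary (Introduction)] [cite: Huybrechts2019, Cor. 0.4 (ii) and Rem. 3.3] -/
theorem cmNorm_selfSimilitude_algebraic (hmk : Huybrechts_K3_marking_exists) (hB : HodgeIsometryAlgebraic)
    {μ : OrientationFamily} (hμ : μ.HasPoincareDuality)
    {S : SchemeOver ℂ} (hS : IsK3Surface S) {p : complexBetti S (2 * 2)} (hp : Gen[S, p])
    (e : complexBetti S (2 * 1) →ₗ[ℂ] complexBetti S (2 * 1))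
    (he_rat : ∀ x, IsRationalClass x → IsRationalClass (e x))
    (he_sim : ∀ (x y : complexBetti S (2 * 1)) (a : ℂ),
      cupProduct (rfl : 2 * 1 + 2 * 1 = 2 * 2) x y = a • p →
        cupProduct (rfl : 2 * 1 + 2 * 1 = 2 * 2) (e x) (e y) = ((2 : ℂ) * a) • p)
    {σ : complexBetti S (2 * 1)} {t : ℂ} (hσ : IsOfHodgeType 2 S (2 * 1) 2 0 σ) (hσ0 : σ ≠ 0)
    (htim : t.im ≠ 0) (heσ : e σ = t • σ) :
    ∃ γ ∈ algebraicClasses (MonoidalCategoryStruct.tensorObj S S) 2,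
      ∀ x : complexBetti S (2 * 1), e x = Corr[μ, S, S, hS, hS ; γ, x] :=
  stub_cmSelfSimilitudeFromIsometries stub_cmCayleyDecomposition stub_cmPolyComplexify stub_cmRationalForm hmk hB
    lefschetzOneOneK3_proof algebraicClassesOneOneK3_proof (hodgeIndex_K3_of_marking hmk lefschetzOneOneK3_proof)
    stub_divisorCorrections μ hμ S hS p hp e he_rat he_sim σ t hσ hσ0 htim heσ

/-! ## A CM-norm-2 surface is its own anchor — from Buskin's theorem -/

/-- **A CM-norm-2 projective K3 surface is its own algebraic `2`-anchor** (`OutAnchor[μ, S, S, …]` with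
`Ψ := e`), granted K3 markings and Buskin's THEOREM (13675): verbatim the landed `outAnchor_self_of_cmNorm`
(p123920) except that the algebraicity `e = [γ_e]_*` comes from `cmNorm_selfSimilitude_algebraic` instead of the
named fact `Buskin2019_hodgeConjectureFor_square_of_CM`.  `e` is bijective (a `2`-similitude of the non-degenerate
K3 form through a marking), algebraic, and `e⁻¹` is rational, type-preserving and halving (`stub_anchorForward` on
the equivalence with inverse `½e`). [cite: Buskin2019, Thm. 1.1 and Corollary (Introduction)] [cite: Huybrechts2019, Cor. 0.4 (ii)]
[cite: Varesco2023, §0.1] -/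
theorem outAnchor_self_of_cmNorm_of_isometries (hmk : Huybrechts_K3_marking_exists)
    (hB : HodgeIsometryAlgebraic) {μ : OrientationFamily} (hμ : μ.HasPoincareDuality)
    {S : SchemeOver ℂ} (hS : IsK3Surface S) {p : complexBetti S (2 * 2)} (hp : Gen[S, p])
    (hcm : CMNorm2[S, p]) : OutAnchor[μ, S, S, hS, hS, p, p] := by
  obtain ⟨e, he_rat, he_sim, σ, t, hσ, hσ0, htim, heσ⟩ := hcm
  obtain ⟨η, p₀, x₀, hp₀0, hm, hx⟩ := hmk S hS
  obtain ⟨hJrat, hJ2, hJx, hJe⟩ := cmNorm_markingConj hS hp η p₀ x₀ hm e he_rat he_sim hσ hσ0 heσ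
  have he_typ : ∀ (i j : ℕ) x, IsOfHodgeType 2 S (2 * 1) i j x → IsOfHodgeType 2 S (2 * 1) i j (e x) :=
    cmNorm_typePreserving hmk hS hp e he_rat he_sim hσ hσ0 heσ
  set J : Module.End ℂ (K3Index → ℂ) := η.toLinearMap ∘ₗ e ∘ₗ η.symm.toLinearMap with hJdef
  -- `J`, hence `e`, is bijective (a `2`-similitude of the non-degenerate K3 form)
  have hJinj : Function.Injective J := by
    refine (injective_iff_map_eq_zero J).2 fun a ha => k3Form_eq_zero_of_forall fun b => ?_
    have h := hJ2 a b
    rw [ha, k3Form_zero_left] at h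
    exact (mul_eq_zero.1 h.symm).resolve_left two_ne_zero
  have hJsurj : Function.Surjective J := LinearMap.surjective_of_injective hJinj
  let Je : (K3Index → ℂ) ≃ₗ[ℂ] (K3Index → ℂ) := LinearEquiv.ofBijective J ⟨hJinj, hJsurj⟩
  let E : complexBetti S (2 * 1) ≃ₗ[ℂ] complexBetti S (2 * 1) := η.trans (Je.trans η.symm)
  have hE : ∀ y, E y = e y := fun y => by
    show η.symm (Je (η y)) = e y
    rw [LinearEquiv.ofBijective_apply, hJe]
  -- `Φ := 2 · e⁻¹`, the equivalence with inverse `½ e`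
  have hhalf : (((1 / 2 : ℚ) : ℂ)) = (2 : ℂ)⁻¹ := by push_cast; ring
  let f : complexBetti S (2 * 1) →ₗ[ℂ] complexBetti S (2 * 1) :=
    (2 : ℂ) • (E.symm : complexBetti S (2 * 1) →ₗ[ℂ] complexBetti S (2 * 1))
  let g : complexBetti S (2 * 1) →ₗ[ℂ] complexBetti S (2 * 1) :=
    (((1 / 2 : ℚ) : ℂ)) • (E : complexBetti S (2 * 1) →ₗ[ℂ] complexBetti S (2 * 1))
  have hfg : ∀ y, f (g y) = y := fun y => by
    simp only [f, g, LinearMap.smul_apply, LinearEquiv.coe_coe, map_smul, LinearEquiv.symm_apply_apply,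
      smul_smul, hhalf, inv_mul_cancel₀ (two_ne_zero' ℂ), one_smul]
  have hgf : ∀ x, g (f x) = x := fun x => by
    simp only [f, g, LinearMap.smul_apply, LinearEquiv.coe_coe, map_smul, LinearEquiv.apply_symm_apply,
      smul_smul, hhalf, mul_inv_cancel₀ (two_ne_zero' ℂ), one_smul]
  let Φ : complexBetti S (2 * 1) ≃ₗ[ℂ] complexBetti S (2 * 1) :=
    LinearEquiv.ofLinear f g (LinearMap.ext hfg) (LinearMap.ext hgf)
  have hΦ : ∀ y, Φ y = (2 : ℂ) • E.symm y := fun y => rfl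
  have hΦ' : ∀ y, Φ.symm y = (((1 / 2 : ℚ) : ℂ)) • e y := fun y => by
    show g y = _
    simp only [g, LinearMap.smul_apply, LinearEquiv.coe_coe, hE]
  -- `Φ⁻¹ = ½ e` is rational, type-preserving and halving, so `Φ = 2 e⁻¹` is rational,
  -- type-preserving and doubling (`stub_anchorForward`)
  have hr : ∀ y, IsRationalClass y → IsRationalClass (Φ.symm y) := fun y hy => by
    rw [hΦ']
    exact (he_rat y hy).smul (1 / 2 : ℚ)
  have ht : ∀ (i j : ℕ) y, IsOfHodgeType 2 S (2 * 1) i j y →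
      IsOfHodgeType 2 S (2 * 1) i j (Φ.symm y) := fun i j y hy => by
    rw [hΦ']
    exact (he_typ i j y hy).smul _
  have hs : ∀ (u v : complexBetti S (2 * 1)) (b : ℂ),
      cupProduct (rfl : 2 * 1 + 2 * 1 = 2 * 2) u v = ((2 : ℂ) * b) • p →
        cupProduct (rfl : 2 * 1 + 2 * 1 = 2 * 2) (Φ.symm u) (Φ.symm v) = b • p := by
    intro u v b huv
    rw [hΦ', hΦ']
    simp only [map_smul, LinearMap.smul_apply]
    rw [he_sim u v ((2 : ℂ) * b) huv, smul_smul, smul_smul, hhalf]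
    congr 1
    ring
  obtain ⟨hΦr, hΦt, hΦs⟩ := stub_anchorForward hmk S S hS hS p p hp hp Φ hr ht hs
  have hEs : ∀ z, E.symm z = (((1 / 2 : ℚ) : ℂ)) • Φ z := fun z => by
    rw [hΦ, smul_smul, hhalf, inv_mul_cancel₀ (two_ne_zero' ℂ), one_smul]
  -- `e = [γ_e]_*` is algebraic: Buskin's THEOREM (not his CM corollary)
  obtain ⟨γ, hγ, heγ⟩ := cmNorm_selfSimilitude_algebraic hmk hB hμ hS hp e he_rat he_sim hσ hσ0 htim heσ
  refine ⟨E, ?_, ?_, ?_, γ, hγ, fun x => ?_⟩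
  · intro y hy
    rw [hEs]
    exact (hΦr y hy).smul (1 / 2 : ℚ)
  · intro i j y hy
    rw [hEs]
    exact (hΦt i j y hy).smul _
  · intro u v b huv
    rw [hEs, hEs]
    simp only [map_smul, LinearMap.smul_apply]
    rw [hΦs u v ((2 : ℂ) * b) huv, smul_smul, smul_smul, hhalf]
    congr 1
    ring
  · rw [hE]
    exact heγ x

/-! ## X at every pair with a CM-norm-2 twin, and 14393 at every CM-norm-2 surface — from Buskin's theorem -/

/-- **X at every pair whose TARGET is CM-norm-2**, granted markings, Buskin's theorem (13675) and
`CupProductAlgebraic` (14350) only: the target is its own anchor (`outAnchor_self_of_cmNorm_of_isometries`), then the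
landed target glue `simAlg_at_of_outAnchor_target` (`½e ∘ ψ` is a rational Hodge isometry; `e⁻¹` algebraic by
the transpose calculus; compose). No sector hypothesis. [cite: Buskin2019, Thm. 1.1] [cite: Varesco2023, §0.1] -/
theorem twinSimilitudeAlgebraic_at_of_cmNorm_target_of_isometries (hmk : Huybrechts_K3_marking_exists)
    (hC : Summit.HodgeConjecture.HodgeConjecture.Theses.EndoscopicMiddleDegree.CupProductAlgebraic)
    (hB : HodgeIsometryAlgebraic) {μ : OrientationFamily} (hμ : μ.HasPoincareDuality)
    (S S' : SchemeOver ℂ) (hS : IsK3Surface S) (hS' : IsK3Surface S')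
    (p : complexBetti S (2 * 2)) (p' : complexBetti S' (2 * 2)) (hp : Gen[S, p]) (hp' : Gen[S', p'])
    (hcm : CMNorm2[S, p]) : XBody[μ, S, S', hS, hS', p, p'] :=
  simAlg_at_of_outAnchor_target hmk hB (compCorr_of_cupProductAlgebraic' hC) hμ hS hp hS hp
    (outAnchor_self_of_cmNorm_of_isometries hmk hB hμ hS hp hcm) S' hS' p' hp'

/-- **X at every pair whose SOURCE is CM-norm-2**, same inputs: the source is its own anchor, then the landed
source glue `simAlg_at_of_outAnchor` (`ψ ∘ e⁻¹` is a rational Hodge isometry, Buskin, compose with `e`).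
[cite: Buskin2019, Thm. 1.1] [cite: Varesco2023, §0.1] -/
theorem twinSimilitudeAlgebraic_at_of_cmNorm_source_of_isometries (hmk : Huybrechts_K3_marking_exists)
    (hC : Summit.HodgeConjecture.HodgeConjecture.Theses.EndoscopicMiddleDegree.CupProductAlgebraic)
    (hB : HodgeIsometryAlgebraic) {μ : OrientationFamily} (hμ : μ.HasPoincareDuality)
    (S S' : SchemeOver ℂ) (hS : IsK3Surface S) (hS' : IsK3Surface S')
    (p : complexBetti S (2 * 2)) (p' : complexBetti S' (2 * 2)) (hp : Gen[S, p]) (hp' : Gen[S', p'])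
    (hcm : CMNorm2[S', p']) : XBody[μ, S, S', hS, hS', p, p'] :=
  fun ψ hψr hψt hψs =>
    simAlg_at_of_outAnchor hB (compCorr_of_cupProductAlgebraic' hC) hμ hS' hS' hp'
      (outAnchor_self_of_cmNorm_of_isometries hmk hB hμ hS' hp' hcm) S hS p hp ψ hψr hψt hψs

/-- **X whenever EITHER twin is CM-norm-2 — WITHOUT Buskin's CM corollary** (markings, 13675, 14350).
[cite: Buskin2019, Thm. 1.1] [cite: Varesco2023, §0.1] -/
theorem twinSimilitudeAlgebraic_at_of_cmNorm_either_of_isometries (hmk : Huybrechts_K3_marking_exists)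
    (hC : Summit.HodgeConjecture.HodgeConjecture.Theses.EndoscopicMiddleDegree.CupProductAlgebraic)
    (hB : HodgeIsometryAlgebraic) {μ : OrientationFamily} (hμ : μ.HasPoincareDuality)
    (S S' : SchemeOver ℂ) (hS : IsK3Surface S) (hS' : IsK3Surface S')
    (p : complexBetti S (2 * 2)) (p' : complexBetti S' (2 * 2)) (hp : Gen[S, p]) (hp' : Gen[S', p'])
    (hcm : CMNorm2[S', p'] ∨ CMNorm2[S, p]) : XBody[μ, S, S', hS, hS', p, p'] := by
  rcases hcm with hcm | hcm
  · exact twinSimilitudeAlgebraic_at_of_cmNorm_source_of_isometries hmk hC hB hμ S S' hS hS' p p' hp hp' hcm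
  · exact twinSimilitudeAlgebraic_at_of_cmNorm_target_of_isometries hmk hC hB hμ S S' hS hS' p p' hp hp' hcm

/-- **The transport crux `TwinTwistorTransport` (stmt-HodgeConjecture-14393) at every CM-norm-2 projective K3
surface — from markings and Buskin's THEOREM** (the self-anchor read as a transport datum, `anchorData_of_outAnchor`:
`Ψ := 2e⁻¹`, algebraic by the transpose calculus; `Ψ⁻¹ = ½e` rational, type-preserving, halving).  Compare the
landed `twinTwistorTransport_at_of_cmNorm` (markings + the CM COROLLARY). [cite: Buskin2019, Thm. 1.1] -/
theorem twinTwistorTransport_at_of_cmNorm_of_isometries (hmk : Huybrechts_K3_marking_exists)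
    (hB : HodgeIsometryAlgebraic) {μ : OrientationFamily} (hμ : μ.HasPoincareDuality)
    {S : SchemeOver ℂ} (hS : IsK3Surface S) {p : complexBetti S (2 * 2)} (hp : Gen[S, p]) (hcm : CMNorm2[S, p]) :
    AnchorData[μ, S, hS, p] :=
  anchorData_of_outAnchor hmk hμ hS hp hS hp (outAnchor_self_of_cmNorm_of_isometries hmk hB hμ hS hp hcm)

/-! ## The crux from the named facts, Buskin's theorem and the r9 residual — nothing else -/

/-- **THE CRUX FROM NAMED FACTS, BUSKIN'S THEOREM AND THE r9 RESIDUAL.**  Granted the named published facts of the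
line (K3 markings and the four hyperkähler facts F1–F4; Voisin I Thm. 11.32 ⊗ ℂ), the ONE open item of this route
entering by name (Buskin `HodgeIsometryAlgebraic`, 13675) and the residual `OffSectorNonCMPairs`,
X = `TwinSimilitudeAlgebraic` holds: by cases — a twin in the HK-Nikulin sector
(`twinSimilitudeAlgebraic_onHKSector_either_of_namedFacts`, Lefschetz `(1,1)` by `lefschetzOneOneK3_proof`), else a
CM-norm-2 twin (`twinSimilitudeAlgebraic_at_of_cmNorm_either_of_isometries`), else the residual.  Compared with the
landed `twinSimilitudeAlgebraic_of_offSectorNonCMPairs` (p124210), Buskin's CM corollary and the Lefschetz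
hypothesis are GONE.  A CONDITIONAL proof of the crux.
[cite: Varesco2023, §0.1, Thm. 2.1 and Prop. 2.5] [cite: CamereEtAl2026, Thm. 1.2] [cite: Buskin2019, Thm. 1.1]
[cite: VoisinHodgeI2002, Thm. 11.32] -/
theorem twinSimilitudeAlgebraic_of_offSectorNonCMPairs_of_isometries
    (h₀ : (Huybrechts_K3_marking_exists ∧ CamereEtAl2026_symplecticInvolution_periodSurjective ∧
        CamereEtAl2023_fixedK3_restriction ∧ Markman2024_rationalHodgeIsometry_algebraic_marked ∧
        Beauville1983_hilbertSquare_markedIncidence))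
    (hV : span_holomorphicBundleChernCharacter_eq_algebraicClasses)
    (hB : HodgeIsometryAlgebraic) (hres : OffSectorNonCMPairs) :
    Summit.HodgeConjecture.HodgeConjecture.Theses.NikulinTwinTransport.TwinSimilitudeAlgebraic := by
  intro μ hμ S S' hS hS' p p' hp hp' ψ hψr hψt hψs
  by_cases hsec : InHKNikulinSector S' ∨ InHKNikulinSector S
  · exact twinSimilitudeAlgebraic_onHKSector_either_of_namedFacts h₀ hV hB lefschetzOneOneK3_proof hμ S S' hS hS'
      p p' hp hp' hsec ψ hψr hψt hψs
  · by_cases hcm : CMNorm2[S', p'] ∨ CMNorm2[S, p]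
    · exact twinSimilitudeAlgebraic_at_of_cmNorm_either_of_isometries h₀.1
        (cupProductAlgebraic_of_chernCharacterSpan hV) hB hμ S S' hS hS' p p' hp hp' hcm ψ hψr hψt hψs
    · exact hres μ hμ S S' hS hS' p p' hp hp' ψ hψr hψt hψs (fun h => hsec (Or.inl h))
        (fun h => hsec (Or.inr h)) (fun h => hcm (Or.inl h)) (fun h => hcm (Or.inr h))

/-- Registered anchor of this file (stub `cmNormFromIsometries_anchor` on the crux item; closed form of
`outAnchor_self_of_cmNorm_of_isometries`): a CM-norm-2 projective K3 surface is its own algebraic `2`-anchor,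
granted K3 markings and Buskin's theorem `HodgeIsometryAlgebraic` (13675) — no CM corollary.
[cite: Buskin2019, Thm. 1.1 and Corollary (Introduction)] [cite: Huybrechts2019, Cor. 0.4 (ii) and Rem. 3.3] -/
theorem cmNormFromIsometries_anchor :
    Huybrechts_K3_marking_exists → HodgeIsometryAlgebraic →
    ∀ (μ : OrientationFamily), μ.HasPoincareDuality →
      ∀ (S : SchemeOver ℂ) (hS : IsK3Surface S) (p : complexBetti S (2 * 2)), Gen[S, p] → CMNorm2[S, p] →
        OutAnchor[μ, S, S, hS, hS, p, p] :=
  fun hmk hB _ hμ _ hS _ hp hcm => outAnchor_self_of_cmNorm_of_isometries hmk hB hμ hS hp hcm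

end Summit.HodgeConjecture.HodgeConjecture.Theorems.NikulinTwinTransport

end
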